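import Literature.MathematicalPhysics.QuantumManyBody.PeriodicHardCoreFormData
import Literature.Analysis.FunctionSpaces.TorusHardCoreCutoffEnergy
import Literature.Analysis.FunctionSpaces.TorusPairCutoffSymmetry
import Literature.Analysis.FunctionSpaces.TorusPairTubeHardy
import HarnessLib

/-!
# The cut-off state: a finite-form state of the hard-core Bose gas pushed off the tubes

`Literature/MathematicalPhysics/QuantumManyBody` support file (everything proved; no definitions, no
named facts), namespace `Literature.MathematicalPhysics.QuantumManyBody.BoseGas`; states in
`L²((ℝ/ℤ)^{N×3}, μ_H)` (Haar product probability measure written explicitly, `= volume`). For a pair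
profile `v` with a hard core of radius `a` (`v = +∞` on `[0,a]`, `0 < a`) in the box of side `L`, a
Bose-symmetric state `η` of finite maximal form, and `ε > 0`, there are arbitrarily small `δ > 0` and
a Bose-symmetric state `ζ` — the class of `χ_δ η`, `χ_δ = Torus.pairCutoff Torus.cutProfile (a/L) δ`
— with

* `maxFormKin L ζ ≤ (1+ε) maxFormKin L η + (2π/L)² · |Fin N × Fin 3| · ε`,
* `maxFormPot w L ζ ≤ maxFormPot w L η` for every profile `w`,
* `‖ζ - η‖² ≤ ε`,

and `χ_δ = 0` wherever some pair has `ρᵢⱼ ≤ a/L + δ` (`Torus.pairCutoff_eq_zero`)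
(`exists_hardCore_cutoffState`). This is `Torus.eventually_pairCutoff_regularization`
(`TorusHardCoreCutoffEnergy`) fed with the data of `PeriodicHardCoreFormData` and the finiteness of
the tube-Hardy integrals (`collar_ne_top_of_maxForm_ne_top`: directional derivatives from
`TorusLineAbsContinuity`, tube Hardy inequality `Torus.lintegral_collar_div_sq_le` of
`TorusPairTubeHardy`), read back in the Hilbert space.

## Mathlib / tree search

Tree: `Torus.eventually_pairCutoff_regularization`, `Torus.lintegral_collar_div_sq_le`,
`Torus.exists_lineDeriv_of_tsum_ne_top`,
`ae_eq_zero_on_tubes_of_maxFormPot_ne_top`, `maxFormKin_eq_tsum_dir`, `Torus.pairCutoff_comp_perm`,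
`ae_eq_comp_perm_of_inner_symm`, `inner_symm_of_ae_eq_comp_perm`, `norm_Lp_two_sq_eq_toReal`.
-/

noncomputable section

open MeasureTheory Filter Set Complex UnitAddTorus
open scoped ENNReal NNReal Topology InnerProductSpace
open Literature.Analysis.FunctionSpaces

namespace Literature.MathematicalPhysics.QuantumManyBody.BoseGas

variable {N : ℕ} {L : ℝ} {v : ℝ → ℝ≥0∞}

/-- Local notation for `L²((ℝ/ℤ)^{3N}, μ_H)` (the `L2T N` of `PeriodicFormDomain.lean`). -/
local notation "L2H " N':max =>
  Lp ℂ 2 (Measure.pi fun _ : Fin N' × Fin 3 => (AddCircle.haarAddCircle : Measure UnitAddCircle))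

/-! ## The tube-Hardy integrals are finite -/

/-- **Finite maximal form makes the tube-Hardy integrals finite**: for `v = +∞` on `[0, a]`, `0 < a`,
`0 < L`, `η ∈ L2H N` with `maxFormKin L η < ∞` and `maxFormPot v L η < ∞`, and `i ≠ j`,
`∫⁻_{r<ρᵢⱼ<6r/5} ‖η‖ₑ²/(ρᵢⱼ - r)² < ∞` with `r = a/L` (global `volume`). [folklore] -/
theorem collar_ne_top_of_maxForm_ne_top (hL : 0 < L) (hvm : Measurable v) {a : ℝ} (ha : 0 < a)
    (hcore : ∀ ρ : ℝ, 0 ≤ ρ → ρ ≤ a → v ρ = ⊤) {η : L2H N} (hT : maxFormKin L η ≠ ⊤) (hP : maxFormPot v L η ≠ ⊤)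
    {i j : Fin N} (hij : i ≠ j) :
    ∫⁻ t in {t | a / L < Torus.pairDist i j t ∧ Torus.pairDist i j t < 6 / 5 * (a / L)},
        ‖(η : UnitAddTorus (Fin N × Fin 3) → ℂ) t‖ₑ ^ 2 / ENNReal.ofReal ((Torus.pairDist i j t - a / L) ^ 2) ≠ ⊤ := by
  -- directional derivatives along the three coordinates of particle `i`
  have hex : ∀ k : Fin 3, ∃ h : UnitAddTorus (Fin N × Fin 3) → ℂ,
      MemLp h 2 volume ∧
      (∀ n : Fin N × Fin 3 → ℤ, mFourierCoeff h n =
        (2 * Real.pi * I * (n (i, k))) • mFourierCoeff (η : UnitAddTorus (Fin N × Fin 3) → ℂ) n) ∧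
      eLpNorm h 2 volume ^ 2 =
        ENNReal.ofReal ((2 * Real.pi) ^ 2) * ∑' n : Fin N × Fin 3 → ℤ, ENNReal.ofReal ((n (i, k) : ℝ) ^ 2) *
          ‖mFourierCoeff (η : UnitAddTorus (Fin N × Fin 3) → ℂ) n‖ₑ ^ 2 :=
    fun k => Torus.exists_lineDeriv_of_tsum_ne_top (i, k) (tsum_dir_ne_top hL hT (i, k))
  choose h hh using hex
  have hηi : Integrable (η : UnitAddTorus (Fin N × Fin 3) → ℂ) volume :=
    (memLp_global η).integrable one_le_two
  have hhi : ∀ k, Integrable (h k) volume :=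
    fun k => (hh k).1.integrable one_le_two
  have hbd := Torus.lintegral_collar_div_sq_le hij (div_pos ha hL) hηi hhi (fun k n => (hh k).2.1 n)
    (ae_eq_zero_of_pairDist_lt hL hvm hcore hP hij)
  refine ne_top_of_le_ne_top ?_ hbd
  refine ENNReal.mul_ne_top (by norm_num) (ENNReal.sum_ne_top.2 fun k _ => ?_)
  have h2 : ∫⁻ t, ‖h k t‖ₑ ^ 2 = eLpNorm (h k) 2 volume ^ 2 := by
    rw [eLpNorm_eq_lintegral_rpow_enorm_toReal two_ne_zero ENNReal.ofNat_ne_top, ENNReal.toReal_ofNat,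
      ← ENNReal.rpow_natCast, ← ENNReal.rpow_mul]
    norm_num
  rw [h2]
  exact ENNReal.pow_ne_top (hh k).1.eLpNorm_ne_top


/-! ## Bounded multipliers on `L2H` -/

section Multiplier

variable {χ : UnitAddTorus (Fin N × Fin 3) → ℝ}

/-- `χ η ∈ L²` for a continuous `χ` with `|χ| ≤ 1`. [folklore] -/
theorem memLp_mul_of_abs_le_one (hχc : Continuous χ) (hχb : ∀ t, |χ t| ≤ 1) (η : L2H N) :
    MemLp (fun t => (χ t : ℂ) * (η : UnitAddTorus (Fin N × Fin 3) → ℂ) t) 2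
      (Measure.pi fun _ : Fin N × Fin 3 => (AddCircle.haarAddCircle : Measure UnitAddCircle)) := by
  have h := Torus.memLp_two_mul_of_bound (B := 1) (Complex.continuous_ofReal.comp hχc).aestronglyMeasurable
    (fun t => by
      rw [Function.comp_apply, Complex.norm_real, Real.norm_eq_abs, NNReal.coe_one]
      exact hχb t) (memLp_global η)
  rwa [Torus.volume_eq_pi_haarAddCircle] at h

/-- The class of `χ η` is `χ η` a.e. (global `volume`). [folklore] -/
theorem coeFn_toLp_mul (hχc : Continuous χ) (hχb : ∀ t, |χ t| ≤ 1) (η : L2H N) :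
    ((memLp_mul_of_abs_le_one hχc hχb η).toLp _ : UnitAddTorus (Fin N × Fin 3) → ℂ) =ᵐ[volume]
      fun t => (χ t : ℂ) * (η : UnitAddTorus (Fin N × Fin 3) → ℂ) t := by
  rw [Torus.volume_eq_pi_haarAddCircle]
  exact (memLp_mul_of_abs_le_one hχc hχb η).coeFn_toLp

/-- The Fourier coefficients of the class of `χ η` are those of the function `χ η`. [folklore] -/
theorem mFourierCoeff_toLp_mul (hχc : Continuous χ) (hχb : ∀ t, |χ t| ≤ 1) (η : L2H N) (n : Fin N × Fin 3 → ℤ) :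
    mFourierCoeff (((memLp_mul_of_abs_le_one hχc hχb η).toLp _ : L2H N) : UnitAddTorus (Fin N × Fin 3) → ℂ) n =
      mFourierCoeff (fun t => (χ t : ℂ) * (η : UnitAddTorus (Fin N × Fin 3) → ℂ) t) n :=
  integral_congr_ae ((memLp_mul_of_abs_le_one hχc hχb η).coeFn_toLp.mono fun t ht => by
    show _ • _ = _ • _
    rw [ht])

/-- **The multiplier does not increase any potential energy** (`|χ| ≤ 1`). [folklore] -/
theorem maxFormPot_toLp_mul_le (hχc : Continuous χ) (hχb : ∀ t, |χ t| ≤ 1) (η : L2H N) (w : ℝ → ℝ≥0∞) (L : ℝ) :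
    maxFormPot w L ((memLp_mul_of_abs_le_one hχc hχb η).toLp _) ≤ maxFormPot w L η := by
  rw [maxFormPot_eq_lintegral, maxFormPot_eq_lintegral]
  refine lintegral_mono_ae ((coeFn_toLp_mul hχc hχb η).mono fun t ht => ?_)
  rw [ht, enorm_mul]
  gcongr
  refine mul_le_of_le_one_left zero_le ?_
  rw [← ofReal_norm, Complex.norm_real, Real.norm_eq_abs]
  exact ENNReal.ofReal_le_one.2 (hχb t)

/-- `‖[χη] - η‖² = (∫⁻ ‖χ η - η‖ₑ²).toReal` (global `volume`). [folklore] -/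
theorem norm_toLp_mul_sub_sq (hχc : Continuous χ) (hχb : ∀ t, |χ t| ≤ 1) (η : L2H N) :
    ‖((memLp_mul_of_abs_le_one hχc hχb η).toLp _ : L2H N) - η‖ ^ 2 =
      (∫⁻ t, ‖(χ t : ℂ) * (η : UnitAddTorus (Fin N × Fin 3) → ℂ) t - (η : UnitAddTorus (Fin N × Fin 3) → ℂ) t‖ₑ ^ 2).toReal := by
  rw [(norm_Lp_two_sq_eq_toReal (((memLp_mul_of_abs_le_one hχc hχb η).toLp _ : L2H N) - η)).1]
  congr 1
  have hsub := Lp.coeFn_sub (((memLp_mul_of_abs_le_one hχc hχb η).toLp _ : L2H N)) η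
  have hmul := (memLp_mul_of_abs_le_one hχc hχb η).coeFn_toLp
  rw [Torus.volume_eq_pi_haarAddCircle]
  refine lintegral_congr_ae ?_
  filter_upwards [hsub, hmul] with t h1 h2
  rw [h1, Pi.sub_apply, h2, enorm_eq_nnnorm]

/-- **A Bose-symmetric multiplier preserves Bose symmetry**: if `χ(t ∘ (σ × id)) = χ(t)` for all
particle permutations `σ`, then `[χ η]` is Bose-symmetric whenever `η` is. [folklore] -/
theorem toLp_mul_mem_boseSymmetric (hχc : Continuous χ) (hχb : ∀ t, |χ t| ≤ 1) (η : L2H N)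
    (hχσ : ∀ (σ : Equiv.Perm (Fin N)) (t : UnitAddTorus (Fin N × Fin 3)),
      χ (fun p : Fin N × Fin 3 => t (σ p.1, p.2)) = χ t)
    (hη : η ∈ boseSymmetric N) :
    ((memLp_mul_of_abs_le_one hχc hχb η).toLp _ : L2H N) ∈ boseSymmetric N := by
  rw [mem_boseSymmetric] at hη ⊢
  intro σ n
  set τ : Equiv.Perm (Fin N × Fin 3) := Equiv.prodCongr σ (Equiv.refl (Fin 3)) with hτ
  have hτn : ∀ m : Fin N × Fin 3 → ℤ, (fun i => m (τ i)) = fun p : Fin N × Fin 3 => m (σ p.1, p.2) :=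
    fun m => comp_prodCongr_eq σ m
  have hτt : ∀ t : UnitAddTorus (Fin N × Fin 3), (fun i => t (τ i)) = fun p : Fin N × Fin 3 => t (σ p.1, p.2) :=
    fun t => by funext p; rcases p with ⟨i, k⟩; rfl
  have hηae := ae_eq_comp_perm_of_inner_symm η τ fun m => by rw [hτn]; exact hη σ m
  have hfc := (memLp_mul_of_abs_le_one hχc hχb η).coeFn_toLp
  set f : L2H N := (memLp_mul_of_abs_le_one hχc hχb η).toLp _ with hf
  have hfcT : ∀ᵐ t ∂(Measure.pi fun _ : Fin N × Fin 3 => (AddCircle.haarAddCircle : Measure UnitAddCircle)),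
      (f : UnitAddTorus (Fin N × Fin 3) → ℂ) (fun i => t (τ i)) =
        (χ (fun i => t (τ i)) : ℂ) * (η : UnitAddTorus (Fin N × Fin 3) → ℂ) (fun i => t (τ i)) := by
    have h := (measurePreserving_compPerm (D := Fin N × Fin 3) τ).quasiMeasurePreserving.ae_eq_comp hfc
    filter_upwards [h] with t ht
    simpa only [Function.comp_apply, compPerm_apply] using ht
  have hfae : ∀ᵐ t ∂(Measure.pi fun _ : Fin N × Fin 3 => (AddCircle.haarAddCircle : Measure UnitAddCircle)),
      (f : UnitAddTorus (Fin N × Fin 3) → ℂ) (fun i => t (τ i)) = (f : UnitAddTorus (Fin N × Fin 3) → ℂ) t := by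
    filter_upwards [hηae, hfc, hfcT] with t h1 h2 h3
    rw [h3, h1, h2, hτt, hχσ σ t]
  rw [← hτn]
  exact inner_symm_of_ae_eq_comp_perm f τ hfae n

end Multiplier

/-! ## The cut-off state -/

/-- **The cut-off state.** Let `v = +∞` on `[0, a]` (`0 < a`), `0 < L`, `η ∈ L²((ℝ/ℤ)^{N×3})`
Bose-symmetric with `maxFormKin L η < ∞` and `maxFormPot v L η < ∞`, `0 < ε`, `0 < δ₀`. Then there are
`δ ∈ (0, δ₀)` and a Bose-symmetric `ζ` — the class of `χ_δ η`, `χ_δ = pairCutoff cutProfile (a/L) δ` —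
with `maxFormKin L ζ ≤ (1+ε) maxFormKin L η + (2π/L)² |Fin N × Fin 3| ε`,
`maxFormPot w L ζ ≤ maxFormPot w L η` for every `w`, and `‖ζ - η‖² ≤ ε`. [folklore] -/
theorem exists_hardCore_cutoffState (hL : 0 < L) (hvm : Measurable v) {a : ℝ} (ha : 0 < a)
    (hcore : ∀ ρ : ℝ, 0 ≤ ρ → ρ ≤ a → v ρ = ⊤) {η : L2H N} (hη : η ∈ boseSymmetric N)
    (hT : maxFormKin L η ≠ ⊤) (hP : maxFormPot v L η ≠ ⊤) {ε : ℝ} (hε : 0 < ε) {δ₀ : ℝ} (hδ₀ : 0 < δ₀) :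
    ∃ δ : ℝ, 0 < δ ∧ δ < δ₀ ∧ ∃ ζ : L2H N,
      ((ζ : UnitAddTorus (Fin N × Fin 3) → ℂ) =ᵐ[volume]
        fun t => (Torus.pairCutoff Torus.cutProfile (a / L) δ t : ℂ) * (η : UnitAddTorus (Fin N × Fin 3) → ℂ) t) ∧
      ζ ∈ boseSymmetric N ∧
      maxFormKin L ζ ≤ ENNReal.ofReal (1 + ε) * maxFormKin L η +
        ENNReal.ofReal ((2 * Real.pi / L) ^ 2) * ((Fintype.card (Fin N × Fin 3) : ℝ≥0∞) * ENNReal.ofReal ε) ∧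
      (∀ w : ℝ → ℝ≥0∞, maxFormPot w L ζ ≤ maxFormPot w L η) ∧
      ‖ζ - η‖ ^ 2 ≤ ε := by
  set r : ℝ := a / L with hr
  have hr0 : 0 < r := div_pos ha hL
  -- the torus-side data
  have hmem := memLp_global η
  have hfin : ∀ i j : Fin N, i ≠ j → ∫⁻ t in {t | r < Torus.pairDist i j t ∧ Torus.pairDist i j t < 6 / 5 * r},
      ‖(η : UnitAddTorus (Fin N × Fin 3) → ℂ) t‖ₑ ^ 2 / ENNReal.ofReal ((Torus.pairDist i j t - r) ^ 2) ≠ ⊤ :=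
    fun i j hij => collar_ne_top_of_maxForm_ne_top hL hvm ha hcore hT hP hij
  have hη0 := ae_eq_zero_on_tubes_of_maxFormPot_ne_top hL hvm hcore hP
  -- the regularisation, eventually in `δ`
  have hev := Torus.eventually_pairCutoff_regularization Torus.isCutProfile_cutProfile hr0 hmem hfin hη0 hε
  have hpos : ∀ᶠ δ in 𝓝[>] (0 : ℝ), 0 < δ ∧ δ < δ₀ := by
    filter_upwards [eventually_mem_nhdsWithin, inter_mem_nhdsWithin (Ioi (0 : ℝ)) (Iio_mem_nhds hδ₀)] with δ h1 h2
    exact ⟨h1, h2.2⟩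
  obtain ⟨δ, ⟨hδ0, hδ1⟩, hkin, hL2⟩ := (hpos.and hev).exists
  -- the cut-off function
  set χ : UnitAddTorus (Fin N × Fin 3) → ℝ := Torus.pairCutoff Torus.cutProfile r δ with hχ
  have hχc : Continuous χ := Torus.continuous_pairCutoff Torus.isCutProfile_cutProfile r δ
  have hχb : ∀ t, |χ t| ≤ 1 := fun t => Torus.abs_pairCutoff_le_one Torus.isCutProfile_cutProfile r δ t
  have hχσ : ∀ (σ : Equiv.Perm (Fin N)) (t : UnitAddTorus (Fin N × Fin 3)),
      χ (fun p : Fin N × Fin 3 => t (σ p.1, p.2)) = χ t := fun σ t => Torus.pairCutoff_comp_perm _ r δ t σ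
  refine ⟨δ, hδ0, hδ1, (memLp_mul_of_abs_le_one hχc hχb η).toLp _, coeFn_toLp_mul hχc hχb η,
    toLp_mul_mem_boseSymmetric hχc hχb η hχσ hη, ?_, fun w => maxFormPot_toLp_mul_le hχc hχb η w L, ?_⟩
  · -- kinetic bound, direction by direction
    rw [maxFormKin_eq_tsum_dir, maxFormKin_eq_tsum_dir, ← mul_assoc, mul_comm (ENNReal.ofReal (1 + ε)), mul_assoc,
      ← mul_add]
    refine mul_le_mul_right ?_ _
    simp only [mFourierCoeff_toLp_mul hχc hχb η]
    calc ∑ q : Fin N × Fin 3, ∑' n : Fin N × Fin 3 → ℤ, ENNReal.ofReal ((n q : ℝ) ^ 2) *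
          ‖mFourierCoeff (fun t => (χ t : ℂ) * (η : UnitAddTorus (Fin N × Fin 3) → ℂ) t) n‖ₑ ^ 2
        ≤ ∑ q : Fin N × Fin 3, (ENNReal.ofReal (1 + ε) * ∑' n : Fin N × Fin 3 → ℤ, ENNReal.ofReal ((n q : ℝ) ^ 2) *
            ‖mFourierCoeff (η : UnitAddTorus (Fin N × Fin 3) → ℂ) n‖ₑ ^ 2 + ENNReal.ofReal ε) :=
          Finset.sum_le_sum fun q _ => hkin q
      _ = _ := by
          rw [Finset.sum_add_distrib, ← Finset.mul_sum, Finset.sum_const, Finset.card_univ, nsmul_eq_mul]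
  · -- `L²` distance
    rw [norm_toLp_mul_sub_sq hχc hχb η]
    exact ENNReal.toReal_le_of_le_ofReal hε.le hL2

end Literature.MathematicalPhysics.QuantumManyBody.BoseGas

end
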